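import Summits.ResolutionOfSingularities.ResolutionOfSingularities.Theorems.RisoStrataDescentAlgclosedToPerfectBlowupDescent
import Literature.AlgebraicGeometry.Resolution.ComponentGluing
import Literature.AlgebraicGeometry.Motives.GaloisDescentIdealSheaf
import Literature.AlgebraicGeometry.Motives.GaloisInvariantIdealSheafStage

/-!
# `RisoStrata.DescentAlgclosedToPerfect` (stmt-ResolutionOfSingularities-0550): Galois descent of
# blow-up resolutions — an `Aut(k̄/k)`-INVARIANT resolving ideal of `X_{k̄}` suffices

Route `ResolutionOfSingularities/RisoStrata` (crux shared verbatim with six other routes). The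
classical mechanism behind "resolution over `k̄` descends to perfect `k` for Galois-EQUIVARIANT
resolutions" (Kollár 2007, 3.34.2 / Thm. 3.36; Bierstone–Grigoriev–Milman–Włodarczyk 2011, Remark
p. 23), machine-checked in blow-up form:

* `hasResolution_of_isBlowup_galoisInvariant` — `L/k` finite Galois, `X` an integral locally
  Noetherian `k`-scheme, `I ≠ 0` an ideal sheaf on `X_L = X ×_k Spec L` invariant under the Galois
  automorphisms `gal σ` (`(gal σ)⁻¹ I·𝒪 = I`), with REGULAR blow-up `Bl_I X_L`: then `X` has a
  resolution of singularities. Proof: the invariant ideal sheaf descends, `I = J·𝒪_{X_L}`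
  (`GaloisDescent.comap_map_fst_eq_of_forall_comap_gal_eq`, Speiser's lemma affine-locally), and
  blow-up resolutions along ideals of the base descend along the field extension
  (`hasResolution_of_isBlowup_comap_fieldExtension`).
* `hasResolution_of_isBlowup_autInvariant` — the same over a normal separable ALGEBRAIC extension
  `K/k` (e.g. `K = k̄`, `k` perfect) for `X` of finite type: an `Aut(K/k)`-invariant resolving ideal
  of `X_K` descends (`GaloisDescent.exists_normal_stage` + `comap_gal_map_eq_map` of
  `Motives/GaloisInvariantIdealSheafStage`: finite normal stage by EGA IV₃ 8.8.2 and lift of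
  automorphisms; then finite Galois descent).
* `descentAlgclosedToPerfect_of_autInvariantResolvingIdeal` — hence **the crux follows from**: for
  every prime `p` with resolution over all algebraically closed fields of characteristic `p`, every
  integral separated `X` of finite type over a perfect field `k` of characteristic `p` has, on
  `X ×_k Spec k̄` (`k̄ = AlgebraicClosure k`), a non-zero ideal sheaf INVARIANT UNDER `Aut(k̄/k)`
  whose blow-up is regular. This is exactly what an invariant-driven resolution algorithm run over
  `k̄` provides (its centres are defined by intrinsic invariants, hence `Aut(k̄/k)`-stable), and
  exactly what bare existence of a resolution of `X_{k̄}` (the antecedent as typed) does not.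
* `descentAlgclosedToPerfect_of_galoisInvariantResolvingIdeal` — the finite-Galois-level variant.
-/

noncomputable section

set_option linter.dupNamespace false -- mandated namespace of this single-conjunct summit

open CategoryTheory CategoryTheory.Limits AlgebraicGeometry
open Literature.AlgebraicGeometry.Resolution
open Literature.AlgebraicGeometry.Resolution (specTo_comp_specOf)
open Literature.AlgebraicGeometry.Motives
open Literature.AlgebraicGeometry.Motives.AbelianVariety (bcSpec)

namespace Summit.ResolutionOfSingularities.ResolutionOfSingularities.Theorems

/-- **Galois descent of a blow-up resolution (finite Galois level).** Let `L/k` be a finite Galois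
extension, `X` an integral locally Noetherian `k`-scheme (`X : SchemeOver k`), `I ≠ ⊥` an ideal
sheaf on `X_L = X ×_k Spec L` with `(gal σ)⁻¹ I·𝒪 = I` for every `σ ∈ Gal(L/k)`, and `ρ : Y ⟶ X_L` a
blow-up along `I` with `Y` regular. Then `X` admits a resolution of singularities (its blow-up
along the descended ideal `I.map pr`). [cite: Kollar2007, 3.34.2 p. 131 and Thm. 3.36;
GortzWedhorn2020, Thm. 14.83 and Prop. 13.91 (2)] -/
theorem hasResolution_of_isBlowup_galoisInvariant {k : Type} [Field k] (L : Type) [Field L]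
    [Algebra k L] [FiniteDimensional k L] [IsGalois k L] (X : SchemeOver k) [IsIntegral X.left]
    [IsLocallyNoetherian X.left] {I : (GaloisDescent.bc L X).IdealSheafData} (hI0 : I ≠ ⊥)
    (hI : ∀ σ : L ≃ₐ[k] L, I.comap (GaloisDescent.gal L X σ) = I) {Y : Scheme.{0}}
    {ρ : Y ⟶ GaloisDescent.bc L X} (hρ : IsBlowup ρ I) (hY : Scheme.IsRegular Y) :
    Scheme.HasResolution X.left := by
  have hdesc := GaloisDescent.comap_map_fst_eq_of_forall_comap_gal_eq L X I hI
  set J := I.map (pullback.fst X.hom (bcSpec k L)) with hJ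
  have hJ0 : J ≠ ⊥ := by
    rintro h
    rw [h, Scheme.IdealSheafData.comap_bot] at hdesc
    exact hI0 hdesc.symm
  rw [← hdesc] at hρ
  exact hasResolution_of_isBlowup_comap_fieldExtension (algebraMap k L) X.hom hJ0 hρ hY

/-- **Galois descent of a blow-up resolution along a normal separable algebraic extension** (e.g.
`K = k̄` for perfect `k`). Let `X` be an integral `k`-scheme of finite type, `I ≠ ⊥` an ideal sheaf
on `X_K = X ×_k Spec K` with `(gal σ)⁻¹ I·𝒪 = I` for every `σ ∈ Aut(K/k)`, and `ρ : Y ⟶ X_K` a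
blow-up along `I` with `Y` regular. Then `X` admits a resolution of singularities: `I = J·𝒪_{X_K}`
for an ideal sheaf `J` on `X` (finite normal stage + finite Galois descent), and the blow-up of `X`
along `J` is a resolution. [cite: Kollar2007, 3.34.2 p. 131 and Thm. 3.36; GortzWedhorn2020,
Thm. 14.83, Thm. 10.66 and Prop. 13.91 (2)] -/
theorem hasResolution_of_isBlowup_autInvariant {k : Type} [Field k] (K : Type) [Field K]
    [Algebra k K] [Normal k K] [Algebra.IsSeparable k K] (X : SchemeOver k) [IsIntegral X.left]
    [LocallyOfFiniteType X.hom] [QuasiCompact X.hom] {I : (GaloisDescent.bc K X).IdealSheafData}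
    (hI0 : I ≠ ⊥) (hI : ∀ σ : K ≃ₐ[k] K, I.comap (GaloisDescent.gal K X σ) = I) {Y : Scheme.{0}}
    {ρ : Y ⟶ GaloisDescent.bc K X} (hρ : IsBlowup ρ I) (hY : Scheme.IsRegular Y) :
    Scheme.HasResolution X.left := by
  -- a finite normal (hence Galois) stage `E` with `(I.map r)·𝒪 = I` for the transition map `r`
  obtain ⟨E, hfin, hnorm, hE⟩ := GaloisDescent.exists_normal_stage K X I
  haveI : IsGalois k ↥E := isGalois_iff.mpr ⟨inferInstance, hnorm⟩
  let r : GaloisDescent.bc K X ⟶ GaloisDescent.bc (↥E) X :=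
    pullback.map X.hom (bcSpec k K) X.hom (bcSpec k ↥E) (𝟙 _)
      (Spec.map (CommRingCat.ofHom (algebraMap (↥E) K))) (𝟙 _) (by simp)
      (by rw [Category.comp_id]; exact (specTo_comp_specOf E).symm)
  have hr₁ : r ≫ pullback.fst X.hom (bcSpec k ↥E) = pullback.fst X.hom (bcSpec k K) :=
    (pullback.lift_fst _ _ _).trans (Category.comp_id _)
  have hr₂ : r ≫ pullback.snd X.hom (bcSpec k ↥E) =
      pullback.snd X.hom (bcSpec k K) ≫ Spec.map (CommRingCat.ofHom (algebraMap (↥E) K)) :=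
    pullback.lift_snd _ _ _
  have hIr := hE r hr₁ hr₂
  -- `I.map r` is `Gal(E/k)`-invariant, hence descends to `X`
  have hinv := GaloisDescent.comap_gal_map_eq_map K X E r hr₁ hr₂ I hI
  have hdesc := GaloisDescent.comap_map_fst_eq_of_forall_comap_gal_eq (↥E) X (I.map r) hinv
  set J := (I.map r).map (pullback.fst X.hom (bcSpec k ↥E)) with hJdef
  have hJ : J.comap (pullback.fst X.hom (bcSpec k K)) = I := by
    rw [← hr₁, Scheme.IdealSheafData.comap_comp, hdesc, hIr]
  have hJ0 : J ≠ ⊥ := by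
    rintro h
    rw [h, Scheme.IdealSheafData.comap_bot] at hJ
    exact hI0 hJ.symm
  rw [← hJ] at hρ
  haveI : IsLocallyNoetherian X.left := LocallyOfFiniteType.isLocallyNoetherian X.hom
  exact hasResolution_of_isBlowup_comap_fieldExtension (algebraMap k K) X.hom hJ0 hρ hY

/-- **Crux `DescentAlgclosedToPerfect` from `Aut(k̄/k)`-invariant resolving ideals.** Suppose that
for every prime `p` for which resolution holds over all algebraically closed fields of
characteristic `p`, every integral separated scheme `X` of finite type over a perfect field `k` of characteristic
`p` carries on `X ×_k Spec k̄` (`k̄ = AlgebraicClosure k`) a non-zero ideal sheaf, invariant under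
all `σ ∈ Aut(k̄/k)`, whose blow-up is regular. Then `DescentAlgclosedToPerfect` holds (reduced ⇒
integral by `ComponentGluing`; then `hasResolution_of_isBlowup_autInvariant`).
[cite: Kollar2007, Thm. 3.36; BierstoneGrigorievMilmanWlodarczyk2011, Remark p. 23] -/
theorem descentAlgclosedToPerfect_of_autInvariantResolvingIdeal
    (H : ∀ p : ℕ, p.Prime →
      (∀ (k : Type) [Field k] [CharP k p] [IsAlgClosed k] (X : Scheme.{0})
        (f : X ⟶ Spec (.of k)), IsSeparated f → LocallyOfFiniteType f → QuasiCompact f →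
        IsReduced X → Scheme.HasResolution X) →
      ∀ (k : Type) [Field k] [CharP k p] [PerfectField k] (X : Scheme.{0}) (f : X ⟶ Spec (.of k)),
        IsSeparated f → LocallyOfFiniteType f → QuasiCompact f → IsIntegral X →
        ∃ (I : (GaloisDescent.bc (AlgebraicClosure k) (Over.mk f)).IdealSheafData) (Y : Scheme.{0})
          (ρ : Y ⟶ GaloisDescent.bc (AlgebraicClosure k) (Over.mk f)),
          I ≠ ⊥ ∧ (∀ σ : AlgebraicClosure k ≃ₐ[k] AlgebraicClosure k,
            I.comap (GaloisDescent.gal (AlgebraicClosure k) (Over.mk f) σ) = I) ∧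
            IsBlowup ρ I ∧ Scheme.IsRegular Y) :
    Summit.ResolutionOfSingularities.ResolutionOfSingularities.Theses.RisoStrata.DescentAlgclosedToPerfect := by
  intro p hp hA k _ _ _ X f hs hl hq hr
  refine ComponentGluing.hasResolution_of_forall_closeds X f fun Z hZ => ?_
  haveI := hZ
  obtain ⟨I, Y, ρ, hI0, hI, hρ, hY⟩ :=
    H p hp hA k _ ((Scheme.IdealSheafData.vanishingIdeal Z).subschemeι ≫ f) inferInstance
      inferInstance inferInstance hZ
  haveI : IsIntegral (Over.mk ((Scheme.IdealSheafData.vanishingIdeal Z).subschemeι ≫ f) :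
      SchemeOver k).left := hZ
  have hlft : LocallyOfFiniteType ((Scheme.IdealSheafData.vanishingIdeal Z).subschemeι ≫ f) :=
    inferInstance
  have hqc : QuasiCompact ((Scheme.IdealSheafData.vanishingIdeal Z).subschemeι ≫ f) :=
    inferInstance
  haveI : LocallyOfFiniteType (Over.mk ((Scheme.IdealSheafData.vanishingIdeal Z).subschemeι ≫ f) :
      SchemeOver k).hom := hlft
  haveI : QuasiCompact (Over.mk ((Scheme.IdealSheafData.vanishingIdeal Z).subschemeι ≫ f) :
      SchemeOver k).hom := hqc
  exact hasResolution_of_isBlowup_autInvariant (AlgebraicClosure k)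
    (Over.mk ((Scheme.IdealSheafData.vanishingIdeal Z).subschemeι ≫ f)) hI0 hI hρ hY

/-- **Crux `DescentAlgclosedToPerfect` from Galois-invariant resolving ideals at a finite Galois
level** (variant): a finite Galois extension `L/k`, a non-zero `Gal(L/k)`-invariant ideal sheaf on
`X ×_k Spec L` and a regular blow-up along it, for every integral separated finite-type `X` over a
perfect `k` (given the antecedent), imply the crux.
[cite: Kollar2007, Thm. 3.36; BierstoneGrigorievMilmanWlodarczyk2011, Remark p. 23] -/
theorem descentAlgclosedToPerfect_of_galoisInvariantResolvingIdeal
    (H : ∀ p : ℕ, p.Prime →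
      (∀ (k : Type) [Field k] [CharP k p] [IsAlgClosed k] (X : Scheme.{0})
        (f : X ⟶ Spec (.of k)), IsSeparated f → LocallyOfFiniteType f → QuasiCompact f →
        IsReduced X → Scheme.HasResolution X) →
      ∀ (k : Type) [Field k] [CharP k p] [PerfectField k] (X : Scheme.{0}) (f : X ⟶ Spec (.of k)),
        IsSeparated f → LocallyOfFiniteType f → QuasiCompact f → IsIntegral X →
        ∃ (L : Type) (_ : Field L) (_ : Algebra k L) (_ : FiniteDimensional k L) (_ : IsGalois k L)
          (I : (GaloisDescent.bc L (Over.mk f)).IdealSheafData) (Y : Scheme.{0})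
          (ρ : Y ⟶ GaloisDescent.bc L (Over.mk f)),
          I ≠ ⊥ ∧ (∀ σ : L ≃ₐ[k] L, I.comap (GaloisDescent.gal L (Over.mk f) σ) = I) ∧
            IsBlowup ρ I ∧ Scheme.IsRegular Y) :
    Summit.ResolutionOfSingularities.ResolutionOfSingularities.Theses.RisoStrata.DescentAlgclosedToPerfect := by
  intro p hp hA k _ _ _ X f hs hl hq hr
  refine ComponentGluing.hasResolution_of_forall_closeds X f fun Z hZ => ?_
  haveI := hZ
  obtain ⟨L, _, _, _, _, I, Y, ρ, hI0, hI, hρ, hY⟩ :=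
    H p hp hA k _ ((Scheme.IdealSheafData.vanishingIdeal Z).subschemeι ≫ f) inferInstance
      inferInstance inferInstance hZ
  haveI : IsIntegral (Over.mk ((Scheme.IdealSheafData.vanishingIdeal Z).subschemeι ≫ f) :
      SchemeOver k).left := hZ
  have hLN : IsLocallyNoetherian (Scheme.IdealSheafData.vanishingIdeal Z).subscheme :=
    LocallyOfFiniteType.isLocallyNoetherian
      ((Scheme.IdealSheafData.vanishingIdeal Z).subschemeι ≫ f)
  haveI : IsLocallyNoetherian (Over.mk ((Scheme.IdealSheafData.vanishingIdeal Z).subschemeι ≫ f) :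
      SchemeOver k).left := hLN
  exact hasResolution_of_isBlowup_galoisInvariant L
    (Over.mk ((Scheme.IdealSheafData.vanishingIdeal Z).subschemeι ≫ f)) hI0 hI hρ hY

end Summit.ResolutionOfSingularities.ResolutionOfSingularities.Theorems

end
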